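import Summits.QuantumFields.YangMills.Theorems.VirialFluxGapCentralFieldDivergence
import Summits.QuantumFields.YangMills.Theorems.VirialFluxGapCentralDrive
import HarnessLib

/-!
# Route `VirialFluxGap` (YangMills): (P2) FOR THE EXPLICIT CENTRAL FIELD ON THE CLOSED CENTRAL WINDOW — the window adapter from w3's drive
# inequality at comb-gauged ring histories to the package shape of ✓`periodicSoftness_of_drive` ∕ ✓`periodicSoftness_of_centralDrive`

Toward the deciding crux `VirialFluxGap.PeriodicSoftness` (item stmt-QuantumFields-24141).  The drive clause (P2) of the central package is
delivered by the w3 lineage at RING HISTORIES `P` in comb gauge under the hypotheses `|z_k|², |z₄|² ≤ ½`, `2|z_k|², 2|z₄|² ≤ ρ̂²`, the sign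
hypotheses and `treeGauge (P.1 0) = 1` (✓`CentralDrive.central_drive_lower`, w3 g59: `2F₀ − E(L, ρ̂, F₀) ≤ frameD (centralDir σ σ₄ M) ringPoly M`).
The assembler's interface (✓`FrameHessian.periodicSoftness_of_drive`, fcl-p3 g41) wants it at the points `x` of `X_fix` glued into ring histories,
on the window «three wrap masses and the seam-root mass `≤ ρ²`, `F_fix x ≤ t_C`», in the form `2(1 − ε_C)·F_fix x ≤ Σ_va centralCoeff·frameGrad`
with `ε_C` an EXPLICIT function of `(L, ρ, t_C)`.  This file is that adapter (same letters as the (P3) adapter ✓`central_divergence_window`):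

* §1 ★ `central_window_hyps` — at a window point (`0 ≤ ρ ≤ 1/5`, `t_C ≤ (4096·L⁴)⁻¹`): comb gauge (✓`treeGauge_glue`), `|z_k|², |z₄|² ≤ ρ′² ≤ ½` and
  `2|z_k|², 2|z₄|² ≤ (2ρ′)²` with `ρ′ := ρ + 16L²√t_C` (✓`blockIm_le_of_window`, ✓`seamIm_le_of_window`, ✓`sixteen_sq_sqrt_le`);
  `window_110000_le_4096` (the assembler's `t_C ≤ (110000L⁴)⁻¹` implies `t_C ≤ (4096L⁴)⁻¹`);
* §2 `drive_error_mono` — the error `E(L, ρ̂, F) = 9216L⁴F² + (384L²√F + 3ρ̂)(3F + 147456L⁴F·N)` is `≤ 2ε·F` on `0 ≤ F ≤ t_C` with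
  `ε := ½[9216L⁴t_C + (384L²√t_C + 3ρ̂)(3 + 147456L⁴N)]`, and `drive_of_core` — `2F − E ≤ D`, `E ≤ 2εF` ⇒ `2(1−ε)F ≤ D`;
* §3 ★★★ `central_drive_window_of_core` — (P2) in package shape from ANY core inequality of that shape (term count `N ≥ 0` abstract), with
  `ε_C(L, ρ, t_C) = ½[9216L⁴t_C + (384L²√t_C + 6ρ′)(3 + 147456L⁴N)]`, `ρ′ = ρ + 16L²√t_C`; ★★★ `central_drive_window` ∕ `central_drive_window'` —
  the unconditional (P2) per point from ✓`CentralDrive.central_drive_lower` (`N = 3L³ + 6L⁴`; the primed form prints `6ρ′` as fcl-p3's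
  ✓`ClosingArithmetic.closing_eps_bound` does).

HONEST LABEL: adapter ∕ arithmetic only; the core drive inequality is w3 g59's (F1 ✓`EulerDefectInequality`, F2 ✓`CentralDriveTerms`, F3 ✓`CentralDrive`);
nothing is closed here; ⟨24141⟩ and ⟨22884⟩ remain OPEN; the Yang–Mills mass gap is NOT proved; no summit is proved by a line.  THEOREMS ONLY
(0 `def`, 0 `sorry`), standard axioms.  Width seat `ym-line-sfw-p2-w2` g53 (cell ym-idea-1, free hands), `--supports stmt-QuantumFields-24141`.
References: [cite: CosteEtAl1985]; [cite: Luscher1983, §2]; [folklore].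
-/

set_option autoImplicit false

noncomputable section

open scoped Matrix BigOperators ContDiff Topology Quaternion
open Literature.MathematicalPhysics.QuantumFieldTheory hiding SU2
open Literature.MathematicalPhysics.QuantumLattice

namespace Summit.QuantumFields.YangMills.Theorems.VirialFluxGap.CentralField

open Summit.QuantumFields.YangMills.Theorems.FemtoTransferGap
open Summit.QuantumFields.YangMills.Theorems.FemtoTransferGap.TT
open Summit.QuantumFields.YangMills.Theorems.FemtoTransferGap.TwoLattice
open Summit.QuantumFields.YangMills.Theorems.FemtoTransferGap.TwoLattice.Flat
open Summit.QuantumFields.YangMills.Theorems.VirialFluxGap.RingDeficit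
open Summit.QuantumFields.YangMills.Theorems.VirialFluxGap.FrameDerivative
open Summit.QuantumFields.YangMills.Theorems.VirialFluxGap.FrameHessian
open Summit.QuantumFields.YangMills.Theorems.VirialFluxGap.FixFrame
open Summit.QuantumFields.YangMills.Theorems.VirialFluxGap.CentralCoercivity

variable {L : ℕ} [NeZero L]

open scoped Matrix.Norms.Frobenius

/-! ## §1 The ring-history hypotheses at a window point -/

/-- ★ **The central-window hypotheses at a glued `X_fix` point.**  For `0 ≤ ρ ≤ 1/5`, `t_C ≤ (4096·L⁴)⁻¹`, at `x : X_fix` with the three wrap masses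
and the seam-root mass `≤ ρ²` and `F_fix x ≤ t_C`, the ring history `P = (glue x.1 ∷ x.2.1, x.2.2)` is in comb gauge and, with `ρ′ := ρ + 16L²√t_C`:
`Σ_a z_{k,a}² ≤ ρ′²`, `Σ_a z_{4,a}² ≤ ρ′²`, `ρ′ ≤ 9/20` (so `≤ ½` and `2·(…) ≤ (2ρ′)²`). [cite: CosteEtAl1985] -/
theorem central_window_hyps
    (x : (OffIdx L → SU2) × ((Fin (2 * L - 1) → GaugeConfig 3 L SU2) × (Site 3 L → SU2))) {ρ t_C : ℝ} (hρ0 : 0 ≤ ρ) (hρ5 : ρ ≤ 1 / 5)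
    (htC : t_C ≤ (4096 * (L : ℝ) ^ 4)⁻¹)
    (hk : ∀ k : Fin 3, 1 - (su2Quat (wrapReps ((Fin.cons (glue x.1) x.2.1 : Fin (2 * L - 1 + 1) → GaugeConfig 3 L SU2) 0) k)).re ^ 2 ≤ ρ ^ 2)
    (hs : 1 - (su2Quat (x.2.2 0)).re ^ 2 ≤ ρ ^ 2)
    (hF : ringDeficit L (fun _ => false) ((Fin.cons (glue x.1) x.2.1 : Fin (2 * L - 1 + 1) → GaugeConfig 3 L SU2), x.2.2) ≤ t_C) :
    treeGauge ((Fin.cons (glue x.1) x.2.1 : Fin (2 * L - 1 + 1) → GaugeConfig 3 L SU2) 0) = 1 ∧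
      (∀ k : Fin 3,
        (blockIm L (wrapBlock L k) k ((Fin.cons (glue x.1) x.2.1 : Fin (2 * L - 1 + 1) → GaugeConfig 3 L SU2), x.2.2) 0) ^ 2 +
          (blockIm L (wrapBlock L k) k ((Fin.cons (glue x.1) x.2.1 : Fin (2 * L - 1 + 1) → GaugeConfig 3 L SU2), x.2.2) 1) ^ 2 +
          (blockIm L (wrapBlock L k) k ((Fin.cons (glue x.1) x.2.1 : Fin (2 * L - 1 + 1) → GaugeConfig 3 L SU2), x.2.2) 2) ^ 2 ≤
        (ρ + 16 * (L : ℝ) ^ 2 * Real.sqrt t_C) ^ 2) ∧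
      (seamIm L ((Fin.cons (glue x.1) x.2.1 : Fin (2 * L - 1 + 1) → GaugeConfig 3 L SU2), x.2.2) 0) ^ 2 +
          (seamIm L ((Fin.cons (glue x.1) x.2.1 : Fin (2 * L - 1 + 1) → GaugeConfig 3 L SU2), x.2.2) 1) ^ 2 +
          (seamIm L ((Fin.cons (glue x.1) x.2.1 : Fin (2 * L - 1 + 1) → GaugeConfig 3 L SU2), x.2.2) 2) ^ 2 ≤
        (ρ + 16 * (L : ℝ) ^ 2 * Real.sqrt t_C) ^ 2 ∧
      0 ≤ ρ + 16 * (L : ℝ) ^ 2 * Real.sqrt t_C ∧ ρ + 16 * (L : ℝ) ^ 2 * Real.sqrt t_C ≤ 9 / 20 ∧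
      Real.sqrt (ringDeficit L (fun _ => false) ((Fin.cons (glue x.1) x.2.1 : Fin (2 * L - 1 + 1) → GaugeConfig 3 L SU2), x.2.2)) ≤ Real.sqrt t_C := by
  set P : (Fin (2 * L - 1 + 1) → GaugeConfig 3 L SU2) × (Site 3 L → SU2) :=
    ((Fin.cons (glue x.1) x.2.1 : Fin (2 * L - 1 + 1) → GaugeConfig 3 L SU2), x.2.2) with hPdef
  have hP0 : P.1 0 = glue x.1 := by simp [hPdef]
  have ht : treeGauge (P.1 0) = 1 := by rw [hP0]; funext y; exact treeGauge_glue x.1 y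
  have hL1 : (1 : ℝ) ≤ L := by exact_mod_cast NeZero.one_le
  have hL2 : 0 ≤ (L : ℝ) ^ 2 := by positivity
  have hF0 : 0 ≤ ringDeficit L (fun _ => false) P := ringDeficit_nonneg _ _
  have hsF : Real.sqrt (ringDeficit L (fun _ => false) P) ≤ Real.sqrt t_C := Real.sqrt_le_sqrt hF
  have hdt : 16 * (L : ℝ) ^ 2 * Real.sqrt t_C ≤ 1 / 4 := sixteen_sq_sqrt_le hL1 htC
  have hle : ρ + 16 * (L : ℝ) ^ 2 * Real.sqrt (ringDeficit L (fun _ => false) P) ≤ ρ + 16 * (L : ℝ) ^ 2 * Real.sqrt t_C := by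
    nlinarith [hsF, hL2]
  have h0 : 0 ≤ ρ + 16 * (L : ℝ) ^ 2 * Real.sqrt (ringDeficit L (fun _ => false) P) := by positivity
  have h012 : 0 ≤ ρ + 12 * (L : ℝ) ^ 2 * Real.sqrt (ringDeficit L (fun _ => false) P) := by positivity
  have hle12 : ρ + 12 * (L : ℝ) ^ 2 * Real.sqrt (ringDeficit L (fun _ => false) P) ≤ ρ + 16 * (L : ℝ) ^ 2 * Real.sqrt t_C := by
    nlinarith [hsF, hL2, Real.sqrt_nonneg (ringDeficit L (fun _ => false) P)]
  have hsq : (ρ + 16 * (L : ℝ) ^ 2 * Real.sqrt (ringDeficit L (fun _ => false) P)) ^ 2 ≤ (ρ + 16 * (L : ℝ) ^ 2 * Real.sqrt t_C) ^ 2 :=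
    pow_le_pow_left₀ h0 hle 2
  have hsq12 : (ρ + 12 * (L : ℝ) ^ 2 * Real.sqrt (ringDeficit L (fun _ => false) P)) ^ 2 ≤ (ρ + 16 * (L : ℝ) ^ 2 * Real.sqrt t_C) ^ 2 :=
    pow_le_pow_left₀ h012 hle12 2
  have hs' : 1 - (su2Quat (P.2 0)).re ^ 2 ≤ ρ ^ 2 := hs
  refine ⟨ht, fun k => (blockIm_le_of_window P ht hρ0 k (hk k)).trans hsq, (seamIm_le_of_window P ht hρ0 hs').trans hsq12, by positivity,
    by linarith, hsF⟩

omit [NeZero L] in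
/-- The assembler's window `t_C ≤ (110000·L⁴)⁻¹` implies this file's `t_C ≤ (4096·L⁴)⁻¹`. [folklore] -/
theorem window_110000_le_4096 {Lr t : ℝ} (hL : 0 < Lr) (ht : t ≤ (110000 * Lr ^ 4)⁻¹) : t ≤ (4096 * Lr ^ 4)⁻¹ := by
  have hL4 : 0 < Lr ^ 4 := by positivity
  exact ht.trans (by rw [inv_le_inv₀ (by positivity) (by positivity)]; nlinarith)

/-! ## §2 Arithmetic: the error of the core inequality is monotone in the window -/

omit [NeZero L] in
/-- The error term of the core drive inequality, `9216L⁴F² + (4·(96L²√F) + 3ρ̂)(3F + 147456L⁴F·N)`, is at most `2ε·F` on `0 ≤ F ≤ t_C` with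
`ε := ½[9216L⁴t_C + (384L²√t_C + 3ρ̂)(3 + 147456L⁴N)]` (`ρ̂, N ≥ 0`). [folklore] -/
theorem drive_error_mono {Lr F t ρh N : ℝ} (hF0 : 0 ≤ F) (hFt : F ≤ t) (hρh : 0 ≤ ρh) (hN : 0 ≤ N) :
    9216 * Lr ^ 4 * F * F + (4 * (96 * Lr ^ 2 * Real.sqrt F) + 3 * ρh) * (3 * F + 147456 * Lr ^ 4 * F * N) ≤
      2 * ((1 / 2 : ℝ) * (9216 * Lr ^ 4 * t + (384 * Lr ^ 2 * Real.sqrt t + 3 * ρh) * (3 + 147456 * Lr ^ 4 * N))) * F := by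
  have hsF : Real.sqrt F ≤ Real.sqrt t := Real.sqrt_le_sqrt hFt
  have hs0 : 0 ≤ Real.sqrt F := Real.sqrt_nonneg _
  have hL4 : 0 ≤ Lr ^ 4 := by positivity
  have hL2 : 0 ≤ Lr ^ 2 := by positivity
  have h1 : 9216 * Lr ^ 4 * F * F ≤ 9216 * Lr ^ 4 * t * F := by
    have := mul_le_mul_of_nonneg_left hFt (by positivity : 0 ≤ 9216 * Lr ^ 4 * F)
    nlinarith [this]
  have hK : 4 * (96 * Lr ^ 2 * Real.sqrt F) + 3 * ρh ≤ 384 * Lr ^ 2 * Real.sqrt t + 3 * ρh := by nlinarith [hsF, hL2]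
  have hK0 : 0 ≤ 4 * (96 * Lr ^ 2 * Real.sqrt F) + 3 * ρh := by positivity
  have hB0 : 0 ≤ 3 + 147456 * Lr ^ 4 * N := by positivity
  have h2 : (4 * (96 * Lr ^ 2 * Real.sqrt F) + 3 * ρh) * (3 * F + 147456 * Lr ^ 4 * F * N) =
      ((4 * (96 * Lr ^ 2 * Real.sqrt F) + 3 * ρh) * (3 + 147456 * Lr ^ 4 * N)) * F := by ring
  have h3 : (4 * (96 * Lr ^ 2 * Real.sqrt F) + 3 * ρh) * (3 + 147456 * Lr ^ 4 * N) ≤ (384 * Lr ^ 2 * Real.sqrt t + 3 * ρh) * (3 + 147456 * Lr ^ 4 * N) :=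
    mul_le_mul_of_nonneg_right hK hB0
  rw [h2]
  nlinarith [h1, mul_le_mul_of_nonneg_right h3 hF0]

omit [NeZero L] in
/-- `2F − E ≤ D` and `E ≤ 2ε·F` give `2(1 − ε)·F ≤ D`. [folklore] -/
theorem drive_of_core {F E D ε : ℝ} (hcore : 2 * F - E ≤ D) (hE : E ≤ 2 * ε * F) : 2 * (1 - ε) * F ≤ D := by nlinarith

/-! ## §3 (P2) in package shape from the core inequality -/

/-- ★★★ **(P2) FOR THE EXPLICIT CENTRAL FIELD, PACKAGE SHAPE, FROM THE CORE INEQUALITY.**  Suppose the core drive inequality holds at every comb-gauged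
ring history on the central region (the announced shape of ★`CentralDrive.central_drive_lower`, with a term-count factor `N ≥ 0`):
`2F₀ − [9216L⁴F₀² + (4·(96L²√F₀) + 3ρ̂)(3F₀ + 147456L⁴F₀·N)] ≤ frameD (centralDir σ σ₄ M) ringPoly M`.  Then for signs `±1`, `0 ≤ ρ ≤ 1/5`,
`t_C ≤ (4096·L⁴)⁻¹`, at every `x : X_fix` with masses `≤ ρ²`, the sign hypotheses and `F_fix x ≤ t_C`:
`2(1 − ε_C)·F_fix x ≤ Σ_va centralCoeff L σ σ₄ va M_x · frameGrad fixFrameStd M_x va` with the EXPLICIT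
`ε_C = ½[9216L⁴t_C + (384L²√t_C + 3·(2ρ′))(3 + 147456L⁴N)]`, `ρ′ = ρ + 16L²√t_C` (✓`centralDrive_eq_frameD`, §1, §2). [cite: CosteEtAl1985] [cite: Luscher1983, §2] -/
theorem central_drive_window_of_core {σ : Fin 3 → ℝ} {σ₄ : ℝ} {N : ℝ} (hN : 0 ≤ N)
    (hcore : ∀ (P : (Fin (2 * L - 1 + 1) → GaugeConfig 3 L SU2) × (Site 3 L → SU2)), treeGauge (P.1 0) = 1 →
      (∀ k : Fin 3, (1 / 2 : ℝ) ≤ σ k * (su2Quat (wrapReps (P.1 0) k)).re) → (1 / 2 : ℝ) ≤ σ₄ * (su2Quat (P.2 0)).re →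
      (∀ k : Fin 3, (blockIm L (wrapBlock L k) k P 0) ^ 2 + (blockIm L (wrapBlock L k) k P 1) ^ 2 + (blockIm L (wrapBlock L k) k P 2) ^ 2 ≤ 1 / 2) →
      (seamIm L P 0) ^ 2 + (seamIm L P 1) ^ 2 + (seamIm L P 2) ^ 2 ≤ 1 / 2 →
      ∀ ρh : ℝ, 0 ≤ ρh →
      (∀ k : Fin 3, 2 * ((blockIm L (wrapBlock L k) k P 0) ^ 2 + (blockIm L (wrapBlock L k) k P 1) ^ 2 + (blockIm L (wrapBlock L k) k P 2) ^ 2) ≤ ρh ^ 2) →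
      2 * ((seamIm L P 0) ^ 2 + (seamIm L P 1) ^ 2 + (seamIm L P 2) ^ 2) ≤ ρh ^ 2 →
      2 * ringDeficit L (fun _ => false) P -
          (9216 * (L : ℝ) ^ 4 * ringDeficit L (fun _ => false) P * ringDeficit L (fun _ => false) P +
            (4 * (96 * (L : ℝ) ^ 2 * Real.sqrt (ringDeficit L (fun _ => false) P)) + 3 * ρh) *
              (3 * ringDeficit L (fun _ => false) P + 147456 * (L : ℝ) ^ 4 * ringDeficit L (fun _ => false) P * N)) ≤
        frameD (centralDir L σ σ₄ (ringCoord L P)) (ringPoly L) (ringCoord L P))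
    (x : (OffIdx L → SU2) × ((Fin (2 * L - 1) → GaugeConfig 3 L SU2) × (Site 3 L → SU2))) {ρ t_C : ℝ} (hρ0 : 0 ≤ ρ) (hρ5 : ρ ≤ 1 / 5)
    (htC : t_C ≤ (4096 * (L : ℝ) ^ 4)⁻¹)
    (hk : ∀ k : Fin 3, 1 - (su2Quat (wrapReps ((Fin.cons (glue x.1) x.2.1 : Fin (2 * L - 1 + 1) → GaugeConfig 3 L SU2) 0) k)).re ^ 2 ≤ ρ ^ 2)
    (hs : 1 - (su2Quat (x.2.2 0)).re ^ 2 ≤ ρ ^ 2)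
    (hW : ∀ k : Fin 3, (1 / 2 : ℝ) ≤ σ k * (su2Quat (wrapReps ((Fin.cons (glue x.1) x.2.1 : Fin (2 * L - 1 + 1) → GaugeConfig 3 L SU2) 0) k)).re)
    (hS : (1 / 2 : ℝ) ≤ σ₄ * (su2Quat (x.2.2 0)).re)
    (hF : ringDeficit L (fun _ => false) ((Fin.cons (glue x.1) x.2.1 : Fin (2 * L - 1 + 1) → GaugeConfig 3 L SU2), x.2.2) ≤ t_C) :
    2 * (1 - (1 / 2 : ℝ) * (9216 * (L : ℝ) ^ 4 * t_C +
          (384 * (L : ℝ) ^ 2 * Real.sqrt t_C + 3 * (2 * (ρ + 16 * (L : ℝ) ^ 2 * Real.sqrt t_C))) * (3 + 147456 * (L : ℝ) ^ 4 * N))) *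
        ringDeficit L (fun _ => false) ((Fin.cons (glue x.1) x.2.1 : Fin (2 * L - 1 + 1) → GaugeConfig 3 L SU2), x.2.2) ≤
      ∑ va, centralCoeff L σ σ₄ va (ringCoord L ((Fin.cons (glue x.1) x.2.1 : Fin (2 * L - 1 + 1) → GaugeConfig 3 L SU2), x.2.2)) *
        frameGrad (L := L) fixFrameStd (ringCoord L ((Fin.cons (glue x.1) x.2.1 : Fin (2 * L - 1 + 1) → GaugeConfig 3 L SU2), x.2.2)) va := by
  set P : (Fin (2 * L - 1 + 1) → GaugeConfig 3 L SU2) × (Site 3 L → SU2) :=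
    ((Fin.cons (glue x.1) x.2.1 : Fin (2 * L - 1 + 1) → GaugeConfig 3 L SU2), x.2.2) with hPdef
  obtain ⟨ht, hz', hz₄', hρ'0, hρ'le, hsF⟩ := central_window_hyps x hρ0 hρ5 htC hk hs hF
  have hρ'sq : (ρ + 16 * (L : ℝ) ^ 2 * Real.sqrt t_C) ^ 2 ≤ 1 / 2 := by nlinarith
  have hz : ∀ k : Fin 3, (blockIm L (wrapBlock L k) k P 0) ^ 2 + (blockIm L (wrapBlock L k) k P 1) ^ 2 + (blockIm L (wrapBlock L k) k P 2) ^ 2 ≤ 1 / 2 :=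
    fun k => (hz' k).trans hρ'sq
  have hz₄ : (seamIm L P 0) ^ 2 + (seamIm L P 1) ^ 2 + (seamIm L P 2) ^ 2 ≤ 1 / 2 := hz₄'.trans hρ'sq
  have hρh0 : 0 ≤ 2 * (ρ + 16 * (L : ℝ) ^ 2 * Real.sqrt t_C) := by positivity
  have hzρ : ∀ k : Fin 3, 2 * ((blockIm L (wrapBlock L k) k P 0) ^ 2 + (blockIm L (wrapBlock L k) k P 1) ^ 2 + (blockIm L (wrapBlock L k) k P 2) ^ 2) ≤
      (2 * (ρ + 16 * (L : ℝ) ^ 2 * Real.sqrt t_C)) ^ 2 := fun k => by nlinarith [hz' k]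
  have hz₄ρ : 2 * ((seamIm L P 0) ^ 2 + (seamIm L P 1) ^ 2 + (seamIm L P 2) ^ 2) ≤ (2 * (ρ + 16 * (L : ℝ) ^ 2 * Real.sqrt t_C)) ^ 2 := by
    nlinarith [hz₄']
  have hS' : (1 / 2 : ℝ) ≤ σ₄ * (su2Quat (P.2 0)).re := hS
  have hc := hcore P ht hW hS' hz hz₄ _ hρh0 hzρ hz₄ρ
  rw [← centralDrive_eq_frameD] at hc
  have hF0 : 0 ≤ ringDeficit L (fun _ => false) P := ringDeficit_nonneg _ _
  exact drive_of_core hc (drive_error_mono hF0 hF hρh0 hN)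

/-- ★★★ **(P2) FOR THE EXPLICIT CENTRAL FIELD, PACKAGE SHAPE** — hypothesis (P2) of ✓`periodicSoftness_of_drive` ∕ ✓`periodicSoftness_of_centralDrive`
per point, from w3 g59's ✓`CentralDrive.central_drive_lower` (term count `N = 3L³ + 6L⁴`): for signs `±1`, `0 ≤ ρ ≤ 1/5`, `t_C ≤ (4096·L⁴)⁻¹`, at every
`x : X_fix` with the three wrap masses and the seam-root mass `≤ ρ²`, the sign hypotheses and `F_fix x ≤ t_C`,
`2(1 − ε_C)·F_fix x ≤ Σ_va centralCoeff L σ σ₄ va M_x · frameGrad fixFrameStd M_x va` with the EXPLICIT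
`ε_C(L, ρ, t_C) = ½[9216L⁴t_C + (384L²√t_C + 6ρ′)(3 + 147456L⁴(3L³ + 6L⁴))]`, `ρ′ = ρ + 16L²√t_C` (here `6ρ′` is printed as `3·(2ρ′)`).
[cite: CosteEtAl1985] [cite: Luscher1983, §2] -/
theorem central_drive_window {σ : Fin 3 → ℝ} (hσ : ∀ k, σ k = 1 ∨ σ k = -1) {σ₄ : ℝ} (hσ₄ : σ₄ = 1 ∨ σ₄ = -1)
    (x : (OffIdx L → SU2) × ((Fin (2 * L - 1) → GaugeConfig 3 L SU2) × (Site 3 L → SU2))) {ρ t_C : ℝ} (hρ0 : 0 ≤ ρ) (hρ5 : ρ ≤ 1 / 5)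
    (htC : t_C ≤ (4096 * (L : ℝ) ^ 4)⁻¹)
    (hk : ∀ k : Fin 3, 1 - (su2Quat (wrapReps ((Fin.cons (glue x.1) x.2.1 : Fin (2 * L - 1 + 1) → GaugeConfig 3 L SU2) 0) k)).re ^ 2 ≤ ρ ^ 2)
    (hs : 1 - (su2Quat (x.2.2 0)).re ^ 2 ≤ ρ ^ 2)
    (hW : ∀ k : Fin 3, (1 / 2 : ℝ) ≤ σ k * (su2Quat (wrapReps ((Fin.cons (glue x.1) x.2.1 : Fin (2 * L - 1 + 1) → GaugeConfig 3 L SU2) 0) k)).re)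
    (hS : (1 / 2 : ℝ) ≤ σ₄ * (su2Quat (x.2.2 0)).re)
    (hF : ringDeficit L (fun _ => false) ((Fin.cons (glue x.1) x.2.1 : Fin (2 * L - 1 + 1) → GaugeConfig 3 L SU2), x.2.2) ≤ t_C) :
    2 * (1 - (1 / 2 : ℝ) * (9216 * (L : ℝ) ^ 4 * t_C +
          (384 * (L : ℝ) ^ 2 * Real.sqrt t_C + 3 * (2 * (ρ + 16 * (L : ℝ) ^ 2 * Real.sqrt t_C))) *
            (3 + 147456 * (L : ℝ) ^ 4 * (3 * (L : ℝ) ^ 3 + 6 * (L : ℝ) ^ 4)))) *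
        ringDeficit L (fun _ => false) ((Fin.cons (glue x.1) x.2.1 : Fin (2 * L - 1 + 1) → GaugeConfig 3 L SU2), x.2.2) ≤
      ∑ va, centralCoeff L σ σ₄ va (ringCoord L ((Fin.cons (glue x.1) x.2.1 : Fin (2 * L - 1 + 1) → GaugeConfig 3 L SU2), x.2.2)) *
        frameGrad (L := L) fixFrameStd (ringCoord L ((Fin.cons (glue x.1) x.2.1 : Fin (2 * L - 1 + 1) → GaugeConfig 3 L SU2), x.2.2)) va := by
  have hN : (0 : ℝ) ≤ 3 * (L : ℝ) ^ 3 + 6 * (L : ℝ) ^ 4 := by positivity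
  exact central_drive_window_of_core hN
    (fun P ht hW' hS' hz hz₄ ρh hρh hzρ hz₄ρ => CentralDrive.central_drive_lower hσ hσ₄ P ht hW' hS' hz hz₄ hρh hzρ hz₄ρ)
    x hρ0 hρ5 htC hk hs hW hS hF

/-- ★★★ **(P2), package shape, with `ε_C` printed as in fcl-p3's closing arithmetic** (`6·(ρ + 16L²√t_C)` instead of `3·(2·(…))`; same theorem).
[cite: CosteEtAl1985] [cite: Luscher1983, §2] -/
theorem central_drive_window' {σ : Fin 3 → ℝ} (hσ : ∀ k, σ k = 1 ∨ σ k = -1) {σ₄ : ℝ} (hσ₄ : σ₄ = 1 ∨ σ₄ = -1)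
    (x : (OffIdx L → SU2) × ((Fin (2 * L - 1) → GaugeConfig 3 L SU2) × (Site 3 L → SU2))) {ρ t_C : ℝ} (hρ0 : 0 ≤ ρ) (hρ5 : ρ ≤ 1 / 5)
    (htC : t_C ≤ (4096 * (L : ℝ) ^ 4)⁻¹)
    (hk : ∀ k : Fin 3, 1 - (su2Quat (wrapReps ((Fin.cons (glue x.1) x.2.1 : Fin (2 * L - 1 + 1) → GaugeConfig 3 L SU2) 0) k)).re ^ 2 ≤ ρ ^ 2)
    (hs : 1 - (su2Quat (x.2.2 0)).re ^ 2 ≤ ρ ^ 2)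
    (hW : ∀ k : Fin 3, (1 / 2 : ℝ) ≤ σ k * (su2Quat (wrapReps ((Fin.cons (glue x.1) x.2.1 : Fin (2 * L - 1 + 1) → GaugeConfig 3 L SU2) 0) k)).re)
    (hS : (1 / 2 : ℝ) ≤ σ₄ * (su2Quat (x.2.2 0)).re)
    (hF : ringDeficit L (fun _ => false) ((Fin.cons (glue x.1) x.2.1 : Fin (2 * L - 1 + 1) → GaugeConfig 3 L SU2), x.2.2) ≤ t_C) :
    2 * (1 - (1 / 2 : ℝ) * (9216 * (L : ℝ) ^ 4 * t_C +
          (384 * (L : ℝ) ^ 2 * Real.sqrt t_C + 6 * (ρ + 16 * (L : ℝ) ^ 2 * Real.sqrt t_C)) *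
            (3 + 147456 * (L : ℝ) ^ 4 * (3 * (L : ℝ) ^ 3 + 6 * (L : ℝ) ^ 4)))) *
        ringDeficit L (fun _ => false) ((Fin.cons (glue x.1) x.2.1 : Fin (2 * L - 1 + 1) → GaugeConfig 3 L SU2), x.2.2) ≤
      ∑ va, centralCoeff L σ σ₄ va (ringCoord L ((Fin.cons (glue x.1) x.2.1 : Fin (2 * L - 1 + 1) → GaugeConfig 3 L SU2), x.2.2)) *
        frameGrad (L := L) fixFrameStd (ringCoord L ((Fin.cons (glue x.1) x.2.1 : Fin (2 * L - 1 + 1) → GaugeConfig 3 L SU2), x.2.2)) va := by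
  have h := central_drive_window hσ hσ₄ x hρ0 hρ5 htC hk hs hW hS hF
  have e : (3 : ℝ) * (2 * (ρ + 16 * (L : ℝ) ^ 2 * Real.sqrt t_C)) = 6 * (ρ + 16 * (L : ℝ) ^ 2 * Real.sqrt t_C) := by ring
  rw [e] at h
  exact h

end Summit.QuantumFields.YangMills.Theorems.VirialFluxGap.CentralField

end
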